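import Summits.QuantumFields.BalabanUV.Beta.D1BFx.TorusJetArrays
import Summits.QuantumFields.BalabanUV.Beta.D1BFx.TorusTraceTadpole

/-!
# TB4-W PART 3b-gh (FILE B1) — the first-order GHOST SITE WORDS of the co-frame jets as periodised `ℤ⁴` arrays (road «BF-x», slot (K))

Owner ruling ρ-g7-1 (1) (journal l.24670): the ghost term of the BF-x transfer (`KGhostTerm` §3) consumes the SITE words
`Mjet₁ s b * Dhat 4 s` and `Ljet s b * Lhat s + Lhat s * Ljet s b` of the co-frame jets (TB4-W PART 2 `TorusCoframeJets`) as
PERIODISED ARRAYS of fixed `ℤ⁴` stencils indexed by the background bond `β = (u, κ)`, in the TA2 currency `arr` of `PeriodicArrays` —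
exactly the shape of the hypotheses `hV ∕ hV' ∕ hW ∕ hAper` of `TorusTraceTadpole.tendsto_hessT_hessKer`.

CONTENT (fine torus `Site 4 s`, `σ := siteOf 4 s`, `b = (σu, κ)` the torus image of the `ℤ⁴` bond `β = (u, κ)`; `D̂ := Dhat 4 s`, `L̂ := Lhat s`,
`Ê_b := Djet s b`):
* §1 `perT s K` [our object]: the torus matrix `(of (periodiseF s (toF K))).submatrix (·,()) (·,())` of a `Unit`-fibred `ℤ⁴` kernel (the `Unit`
  re-indexing of K-TB3c); linearity in `K` (row-summable `K`); PRODUCT RULES `perT A · perT (arr W) = perT (arr (A ∘ W))`,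
  `perT (arr W) · perT A = perT (arr (W ∘ A))` for a decaying jointly `s`-periodic leg `A` and a bi-localised `W` (TA2 `comp_arr_right∕left` +
  the fibred product rule); `L̂ = perT lapU`.
* §2 `lapU` [our object]: the `Unit`-fibred reading of `−Δ = lapKer`; `Decays lapU (16·e) 1`, translation invariance, joint periodicity, row sums.
* §3 the stencils [our objects] `etD κ u := ghCnt κ u − ptPair (u + e_κ) u` (table of `Ê_bᵀ D̂`), `Lgh κ u := ghCur κ u ∘ lapU + lapU ∘ ghCur κ u`
  (table of `(L̂²)_b := Ljet_b L̂ + L̂ Ljet_b`), `Xgh κ u := ghCur κ u ∘ lapU − lapU ∘ etD κ u` (table of `Mjet₁ b · D̂`); each `BiLoc` at `(u, u)` with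
  ONE common constant∕rate (`cL`, `cX`, rate `1/2`) and translation-covariant `𝒳 κ (u + v) = shiftK (−v) (𝒳 κ u)`.
* §4 the torus identities, for EVERY `s`: `Ê_bᵀ D̂ = perT (arr (etD κ u))`, `Ljet_b = perT (arr (ghCur κ u))`, `Ljet_b L̂ = perT (arr (ghCur ∘ lapU))`,
  `L̂ Ljet_b = perT (arr (lapU ∘ ghCur))`, `Ljet_b L̂ + L̂ Ljet_b = perT (arr (Lgh κ u))`, `Mjet₁ b D̂ = Ljet_b L̂ − L̂ (Ê_bᵀ D̂) = perT (arr (Xgh κ u))`.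

The pair words (`Mjet₁₁ b b′ · D̂`, the four-term `(L̂²)_{bb′}`) and the N-side words are the subject of the sequel files (3b-gh B2 ∕ 3b-N).
Everything here is [folklore] finite-stencil algebra + the TA2 array calculus; the definitions assert nothing.
-/

noncomputable section

namespace Summit.QuantumFields.BalabanUV.Beta.D1BFx.TorusGhostWordArrays

open Matrix
open scoped BigOperators
open Literature.MathematicalPhysics.QuantumFieldTheory.Balaban1983to89
open Literature.MathematicalPhysics.QuantumFieldTheory.Balaban1983to89.Beta
open B12Sec2to5 (l1 l1_nonneg)
open B6QGQLower276 (lapKer lapDir e)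
open ExpKernelCalculus (MKer BiLoc Decays Zl comp shiftK comp_shiftK biLoc_comp_decays)

open AffineAveraging (unitVec)
open KernelWard (bdd_of_decays biLoc_add biLoc_sub)
open BalabanStepJetsSucc (biLoc_comp_right)
open Summit.QuantumFields.BalabanUV.Beta.D1BFx.PeriodicArrays (arr toF toF_apply Kfib_toF periodise₂_arr arr_imageShift rowBound_arr decays_arr
  summable_arr_term comp_arr_left)
open Summit.QuantumFields.BalabanUV.Beta.D1BFx.FibredPeriodisation (Kfib Kfib_apply periodiseF periodiseF_apply periodiseF_compF_matrix)
open Summit.QuantumFields.BalabanUV.Beta.D1BFx.TorusTraceTadpole (toF_comp summable_mul_of_decays_bdd periodiseF_toF_mul_arr)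
open Summit.QuantumFields.BalabanUV.Beta.D1BFx.GhostStencil (ghCur ghCur_apply biLoc_ghCur ghCur_translate ghCnt ghCnt_apply biLoc_ghCnt ghCnt_translate
  l1_zero l1_unitVec)
open Summit.QuantumFields.BalabanUV.Beta.D1BFx.GhostLeg (lapKer_translate)
open Summit.QuantumFields.BalabanUV.Beta.D1BFx.PeriodisedKernels (isPeriodic₂_lapKer rowBound_lapKer)
open Summit.QuantumFields.BalabanUV.Beta.D1BFx.PeriodisedProjector (Lhat)
open Summit.QuantumFields.BalabanUV.Beta.D1BFx.TorusHodgeWeight (Dhat Dhat_transpose_mul_Dhat)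
open Summit.QuantumFields.BalabanUV.Beta.D1BFx.TorusCoframeJets (Djet Ljet Mjet₁ transpose_Djet_mul_Dhat_apply)
open Summit.QuantumFields.BalabanUV.Beta.D1BFx.TorusJetArrays (tip_siteOf ptPair ptPair_apply periodise_arr_ptPair Ljet_eq_arr)

variable (s : ℕ) [NeZero s]

/-! ## §1 The torus matrix of a `Unit`-fibred `ℤ⁴` kernel -/

section PerT

/-- [our object] **THE TORUS MATRIX OF A `Unit`-FIBRED `ℤ⁴` KERNEL**: `perT s K := (of (periodiseF s (toF K))).submatrix (·,()) (·,())`, i.e.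
`perT s K x z = Σ'_n K x̃ (z̃ + s·n)` on window representatives (the `Unit` re-indexing used by K-TB3c). A definition; asserts nothing. -/
def perT (K : MKer 4 Unit) : Matrix (Site 4 s) (Site 4 s) ℝ :=
  (Matrix.of (periodiseF s (toF K))).submatrix (fun x => (x, ())) (fun z => (z, ()))

/-- [our object] Unfolding `perT` to the fibred periodisation. -/
theorem perT_apply (K : MKer 4 Unit) (x z : Site 4 s) : perT s K x z = periodiseF s (toF K) (x, ()) (z, ()) := rfl

/-- [our object] Unfolding `perT` to the image series. -/
theorem perT_apply_tsum (K : MKer 4 Unit) (x z : Site 4 s) :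
    perT s K x z = ∑' n : (Fin 4 → ℤ), K (windowMap 4 s x) (imageShift s (windowMap 4 s z) n) () () := rfl

omit [NeZero s] in
/-- [folklore] The `Unit` re-indexing `x ↦ (x, ())` is a bijection. -/
theorem bijective_prodUnit : Function.Bijective (fun x : Site 4 s => (x, ())) :=
  ⟨fun _ _ h => congrArg Prod.fst h, fun ⟨x, _⟩ => ⟨x, rfl⟩⟩

/-- [folklore] Re-indexed products: `M.sub · N.sub = (M · N).sub` along the `Unit` re-indexing. -/
theorem submatrix_unit_mul (M N : Matrix (Site 4 s × Unit) (Site 4 s × Unit) ℝ) :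
    M.submatrix (fun x => (x, ())) (fun z => (z, ())) * N.submatrix (fun x => (x, ())) (fun z => (z, ()))
      = (M * N).submatrix (fun x => (x, ())) (fun z => (z, ())) :=
  (Matrix.submatrix_mul M N _ _ _ (bijective_prodUnit s)).symm

variable {K L : MKer 4 Unit}

/-- [folklore] Additivity of `perT` on row-summable kernels. -/
theorem perT_add (hK : ∀ x, Summable fun y => K x y () ()) (hL : ∀ x, Summable fun y => L x y () ()) :
    perT s (K + L) = perT s K + perT s L := by
  ext x z
  rw [Matrix.add_apply, perT_apply_tsum, perT_apply_tsum, perT_apply_tsum]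
  exact (summable_row_imageShift (K := fun x y => K x y () ()) hK _ _).tsum_add
    (summable_row_imageShift (K := fun x y => L x y () ()) hL _ _)

/-- [folklore] Subtractivity of `perT` on row-summable kernels. -/
theorem perT_sub (hK : ∀ x, Summable fun y => K x y () ()) (hL : ∀ x, Summable fun y => L x y () ()) :
    perT s (K - L) = perT s K - perT s L := by
  ext x z
  rw [Matrix.sub_apply, perT_apply_tsum, perT_apply_tsum, perT_apply_tsum]
  exact (summable_row_imageShift (K := fun x y => K x y () ()) hK _ _).tsum_sub
    (summable_row_imageShift (K := fun x y => L x y () ()) hL _ _)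

variable {V W : MKer 4 Unit} {p q p' q' : (Fin 4 → ℤ)} {C δ C' δ' CA δA : ℝ} {A : MKer 4 Unit}

/-- [folklore] Rows of the array of a bi-localised stencil are summable (TA2 `rowBound_arr`). -/
theorem summable_row_arr (hV : BiLoc V p q C δ) (hδ : 0 < δ) (x : (Fin 4 → ℤ)) : Summable fun y => arr s V x y () () :=
  ((rowBound_arr hV hδ s () ()) x).1.of_abs

/-- [folklore] Rows of a decaying leg are summable. -/
theorem summable_row_of_decays (hA : Decays A CA δA) (hδA : 0 < δA) (x : (Fin 4 → ℤ)) : Summable fun y => A x y () () :=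
  (((show Decay₂ (Kfib (toF A) () ()) CA δA from fun x y => hA x y () ()).rowBound hδA) x).1.of_abs

/-- [folklore] The array is additive on bi-localised stencils. -/
theorem arr_add (hV : BiLoc V p q C δ) (hδ : 0 < δ) (hW : BiLoc W p' q' C' δ') (hδ' : 0 < δ') : arr s (V + W) = arr s V + arr s W := by
  funext x y a b
  exact (summable_arr_term hV hδ s x y a b).tsum_add (summable_arr_term hW hδ' s x y a b)

/-- [folklore] The array is subtractive on bi-localised stencils. -/
theorem arr_sub (hV : BiLoc V p q C δ) (hδ : 0 < δ) (hW : BiLoc W p' q' C' δ') (hδ' : 0 < δ') : arr s (V - W) = arr s V - arr s W := by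
  funext x y a b
  exact (summable_arr_term hV hδ s x y a b).tsum_sub (summable_arr_term hW hδ' s x y a b)

/-- [folklore] **LEG × ARRAY ON THE TORUS**: `perT A · perT (arr W) = perT (arr (A ∘ W))` for a decaying jointly `s`-periodic leg `A` and a bi-localised
`W` (K-TB3c's `periodiseF_toF_mul_arr`, re-indexed). -/
theorem perT_mul_perT_arr (hA : Decays A CA δA) (hδA : 0 < δA) (hAper : ∀ x y t, ∀ a b : Unit, A (imageShift s x t) (imageShift s y t) a b = A x y a b)
    (hW : BiLoc W p q C δ) (hδ : 0 < δ) : perT s A * perT s (arr s W) = perT s (arr s (comp A W)) := by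
  rw [perT, perT, perT, submatrix_unit_mul, periodiseF_toF_mul_arr hA hδA hAper hW hδ]

/-- [folklore] **ARRAY × LEG ON THE TORUS**: `perT (arr W) · perT A = perT (arr (W ∘ A))` (TA2 `comp_arr_left` + the fibred product rule; the left
factor's rows are absolutely summable by `rowBound_arr`, the right factor is jointly periodic with the uniform row bound of its decay). -/
theorem perT_arr_mul_perT (hA : Decays A CA δA) (hδA : 0 < δA) (hAper : ∀ x y t, ∀ a b : Unit, A (imageShift s x t) (imageShift s y t) a b = A x y a b)
    (hW : BiLoc W p q C δ) (hδ : 0 < δ) : perT s (arr s W) * perT s A = perT s (arr s (comp W A)) := by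
  rw [perT, perT, perT, submatrix_unit_mul, ← comp_arr_left hA hδA hAper hW hδ,
    ← toF_comp (fun x z a b f => summable_mul_of_decays_bdd (decays_arr hW hδ s) (half_pos hδ) (bdd_of_decays hA hδA.le) x z a b f),
    periodiseF_compF_matrix (L := toF A) (fun a b x => ((rowBound_arr hW hδ s a b) x).1) (fun b c x y n => hAper x y n b c)
      (fun b c => (show Decay₂ (Kfib (toF A) b c) CA δA from fun x y => hA x y b c).rowBound hδA)]

end PerT

/-! ## §2 The `Unit`-fibred Laplacian leg -/

section LapU

/-- [our object] **THE `Unit`-FIBRED READING OF `−Δ`**: `lapU x z () () := lapKer x z`. A definition; asserts nothing. -/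
def lapU : MKer 4 Unit := fun x z _ _ => lapKer (d := 4) x z

/-- [our object] Unfolding `lapU`. -/
@[simp] theorem lapU_apply (x z : (Fin 4 → ℤ)) (a b : Unit) : lapU x z a b = lapKer x z := rfl

/-- [folklore] `L̂ = perT lapU` (both are `of (periodise₂ s lapKer)`). -/
theorem Lhat_eq_perT : Lhat s = perT s lapU := rfl

/-- [folklore] An indicator supported where `|x − y|₁ ≤ 1` is dominated by `c·e·e^{−|x − y|₁}` (`0 ≤ c`). -/
theorem abs_ite_le_exp {P : Prop} [Decidable P] {x y : (Fin 4 → ℤ)} {c : ℝ} (hc : 0 ≤ c) (h : P → l1 (x - y) ≤ 1) :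
    |(if P then c else 0)| ≤ c * Real.exp 1 * Real.exp (-1 * l1 (x - y)) := by
  by_cases hP : P
  · rw [if_pos hP, abs_of_nonneg hc, mul_assoc, ← Real.exp_add]
    have h1 : (1 : ℝ) ≤ Real.exp (1 + -1 * l1 (x - y)) := Real.one_le_exp (by have := h hP; linarith)
    nlinarith
  · rw [if_neg hP, abs_zero]; positivity

/-- [folklore] The directional second difference is dominated by `4e·e^{−|x − y|₁}`. -/
theorem abs_lapDir_le (μ : Fin 4) (x y : Fin 4 → ℤ) : |lapDir μ x y| ≤ 4 * Real.exp 1 * Real.exp (-1 * l1 (x - y)) := by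
  have h1 : |(if y = x then (2 : ℝ) else 0)| ≤ 2 * Real.exp 1 * Real.exp (-1 * l1 (x - y)) :=
    abs_ite_le_exp (by norm_num) fun h => by rw [h, sub_self, l1_zero]; norm_num
  have h2 : |(if y = x + e μ then (1 : ℝ) else 0)| ≤ 1 * Real.exp 1 * Real.exp (-1 * l1 (x - y)) :=
    abs_ite_le_exp zero_le_one fun h => by
      rw [h, sub_add_cancel_left, Beta.l1_neg]; exact (l1_unitVec (κ' := μ)).le
  have h3 : |(if y = x - e μ then (1 : ℝ) else 0)| ≤ 1 * Real.exp 1 * Real.exp (-1 * l1 (x - y)) :=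
    abs_ite_le_exp zero_le_one fun h => by rw [h, sub_sub_cancel]; exact (l1_unitVec (κ' := μ)).le
  have e0 : lapDir μ x y = (if y = x then (2 : ℝ) else 0) - (if y = x + e μ then (1 : ℝ) else 0) - (if y = x - e μ then (1 : ℝ) else 0) := rfl
  rw [e0]
  have hA := abs_sub ((if y = x then (2 : ℝ) else 0) - (if y = x + e μ then (1 : ℝ) else 0)) (if y = x - e μ then (1 : ℝ) else 0)
  have hB := abs_sub (if y = x then (2 : ℝ) else 0) (if y = x + e μ then (1 : ℝ) else 0)
  linarith

/-- [folklore] **`−Δ` IS A DECAYING LEG**: `Decays lapU (16·e) 1` (finite range `≤ 1`, entries `≤ 8`). -/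
theorem decays_lapU : Decays lapU (16 * Real.exp 1) 1 := by
  intro x y a b
  rw [lapU_apply]
  unfold lapKer
  calc |∑ μ, lapDir μ x y| ≤ ∑ μ, |lapDir μ x y| := Finset.abs_sum_le_sum_abs _ _
    _ ≤ ∑ _μ : Fin 4, 4 * Real.exp 1 * Real.exp (-1 * l1 (x - y)) := Finset.sum_le_sum fun μ _ => abs_lapDir_le μ x y
    _ = 16 * Real.exp 1 * Real.exp (-1 * l1 (x - y)) := by rw [Finset.sum_const, Finset.card_univ, Fintype.card_fin]; ring

/-- [folklore] `−Δ` is translation invariant: `shiftK v lapU = lapU`. -/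
theorem shiftK_lapU (v : (Fin 4 → ℤ)) : shiftK v lapU = lapU := by
  funext x z a b
  exact lapKer_translate x z v

omit [NeZero s] in
/-- [folklore] `−Δ` is jointly `s`-periodic (the `hAper` shape of the torus product rules). -/
theorem lapU_imageShift (x y t : (Fin 4 → ℤ)) (a b : Unit) : lapU (imageShift s x t) (imageShift s y t) a b = lapU x y a b :=
  isPeriodic₂_lapKer s x y t

/-- [folklore] Rows of `−Δ` are summable. -/
theorem summable_row_lapU (x : (Fin 4 → ℤ)) : Summable fun y => lapU x y () () := ((rowBound_lapKer 0) x).1.of_abs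

end LapU

/-! ## §3 The first-order ghost stencils on `ℤ⁴` -/

section Stencils

variable (κ : Fin 4) (u : (Fin 4 → ℤ))

/-- [our object] **THE TABLE OF `Ê_bᵀ D̂`**: `etD κ u := ghCnt κ u − ptPair (u + e_κ) u`, i.e. `[x = u+e_κ]([z = u+e_κ] − [z = u])` (the transposed bond
jet of `D_U` against the free difference). A definition; asserts nothing. -/
def etD : MKer 4 Unit := ghCnt κ u - ptPair (u + unitVec κ) u

/-- [our object] **THE TABLE OF THE FIRST JET OF `L̂²`**: `Lgh κ u := ghCur κ u ∘ lapU + lapU ∘ ghCur κ u` (word `Ljet_b L̂ + L̂ Ljet_b`). A definition. -/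
def Lgh : MKer 4 Unit := comp (ghCur κ u) lapU + comp lapU (ghCur κ u)

/-- [our object] **THE TABLE OF THE GHOST WORD `Mjet₁ b · D̂`**: `Xgh κ u := ghCur κ u ∘ lapU − lapU ∘ etD κ u` (word `Ljet_b L̂ − L̂ (Ê_bᵀ D̂)`).
A definition; asserts nothing. -/
def Xgh : MKer 4 Unit := comp (ghCur κ u) lapU - comp lapU (etD κ u)

/-- [our object] Unfolding `etD`. -/
theorem etD_apply (x z : (Fin 4 → ℤ)) (a b : Unit) :
    etD κ u x z a b = (if x = u + unitVec κ ∧ z = u + unitVec κ then (1 : ℝ) else 0) - (if x = u + unitVec κ ∧ z = u then (1 : ℝ) else 0) := rfl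

/-- [folklore] `ghCnt κ u = ptPair (u + e_κ) (u + e_κ)`. -/
theorem ghCnt_eq_ptPair : ghCnt κ u = ptPair (u + unitVec κ) (u + unitVec κ) := rfl

/-- [folklore] LOCALISATION of the hop `ptPair (u + e_κ) u` at `(u, u)`: constant `e^{δ}` (every real `δ`). -/
theorem biLoc_hop (δ : ℝ) : BiLoc (ptPair (u + unitVec κ) u) u u (Real.exp δ) δ := by
  intro x z a b
  rw [ptPair_apply]
  by_cases h : x = u + unitVec κ ∧ z = u
  · obtain ⟨hx, hz⟩ := h
    rw [if_pos ⟨hx, hz⟩, abs_one, hx, hz, add_sub_cancel_left, sub_self, l1_unitVec, l1_zero, add_zero, mul_one, ← Real.exp_add,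
      add_neg_cancel, Real.exp_zero]
  · rw [if_neg h, abs_zero]; positivity

/-- [folklore] LOCALISATION of `etD` at `(u, u)`: constant `e^{2δ} + e^{δ}` (every real `δ`). -/
theorem biLoc_etD (δ : ℝ) : BiLoc (etD κ u) u u (Real.exp (2 * δ) + Real.exp δ) δ := biLoc_sub (biLoc_ghCnt κ u δ) (biLoc_hop κ u δ)

/-- [our object] The common localisation constant of the `L̂²`-word tables `Lgh` (rate `1/2`). -/
def cL : ℝ := (Fintype.card Unit : ℝ) * (Real.exp 1 * (16 * Real.exp 1)) * Zl 4 (1 - 1 / 2)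
  + (Fintype.card Unit : ℝ) * (16 * Real.exp 1 * Real.exp 1) * Zl 4 (1 - 1 / 2)

/-- [our object] The common localisation constant of the ghost-word tables `Xgh` (rate `1/2`). -/
def cX : ℝ := (Fintype.card Unit : ℝ) * (Real.exp 1 * (16 * Real.exp 1)) * Zl 4 (1 - 1 / 2)
  + (Fintype.card Unit : ℝ) * (16 * Real.exp 1 * (Real.exp (2 * 1) + Real.exp 1)) * Zl 4 (1 - 1 / 2)

/-- [folklore] **LOCALISATION SOCKET** of `Lgh`: `BiLoc (Lgh κ u) u u cL (1/2)`, ONE constant and rate for all bonds (hypothesis `hV` of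
`tendsto_hessT_hessKer`). -/
theorem biLoc_Lgh : BiLoc (Lgh κ u) u u cL (1 / 2) :=
  biLoc_add (biLoc_comp_right (biLoc_ghCur κ u 1) decays_lapU (by norm_num) (by norm_num))
    (biLoc_comp_decays decays_lapU (biLoc_ghCur κ u 1) (by norm_num) (by norm_num))

/-- [folklore] **LOCALISATION SOCKET** of `Xgh`: `BiLoc (Xgh κ u) u u cX (1/2)`. -/
theorem biLoc_Xgh : BiLoc (Xgh κ u) u u cX (1 / 2) :=
  biLoc_sub (biLoc_comp_right (biLoc_ghCur κ u 1) decays_lapU (by norm_num) (by norm_num))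
    (biLoc_comp_decays decays_lapU (biLoc_etD κ u 1) (by norm_num) (by norm_num))

/-- [folklore] `BiLoc (etD κ u) u u (e² + e) (1/2)` (the rate-`1/2` form used by the product rules below). -/
theorem biLoc_etD_half : BiLoc (etD κ u) u u (Real.exp (2 * (1 / 2)) + Real.exp (1 / 2)) (1 / 2) := biLoc_etD κ u (1 / 2)

/-- [folklore] Translation covariance of the point pair: `ptPair (p + v) (q + v) = shiftK (−v) (ptPair p q)`. -/
theorem ptPair_translate (p q v : (Fin 4 → ℤ)) : ptPair (p + v) (q + v) = shiftK (-v) (ptPair p q) := by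
  funext x z a b
  show ptPair (p + v) (q + v) x z a b = ptPair p q (x + -v) (z + -v) a b
  simp only [ptPair_apply, ← sub_eq_add_neg, sub_eq_iff_eq_add]

/-- [folklore] `shiftK` is additive. -/
theorem shiftK_add (v : (Fin 4 → ℤ)) (K L : MKer 4 Unit) : shiftK v (K + L) = shiftK v K + shiftK v L := rfl

/-- [folklore] `shiftK` is subtractive. -/
theorem shiftK_sub (v : (Fin 4 → ℤ)) (K L : MKer 4 Unit) : shiftK v (K - L) = shiftK v K - shiftK v L := rfl

/-- [folklore] **COVARIANCE** of `etD`: `etD κ (u + v) = shiftK (−v) (etD κ u)` (hypothesis `hAper`-companion `hVcov` of the socket). -/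
theorem etD_translate (v : (Fin 4 → ℤ)) : etD κ (u + v) = shiftK (-v) (etD κ u) := by
  rw [etD, etD, shiftK_sub, ghCnt_translate, add_right_comm u v (unitVec κ), ptPair_translate]

/-- [folklore] **COVARIANCE** of `Lgh`: `Lgh κ (u + v) = shiftK (−v) (Lgh κ u)`. -/
theorem Lgh_translate (v : (Fin 4 → ℤ)) : Lgh κ (u + v) = shiftK (-v) (Lgh κ u) := by
  rw [Lgh, Lgh, shiftK_add, ghCur_translate, ← comp_shiftK, ← comp_shiftK, shiftK_lapU]

/-- [folklore] **COVARIANCE** of `Xgh`: `Xgh κ (u + v) = shiftK (−v) (Xgh κ u)`. -/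
theorem Xgh_translate (v : (Fin 4 → ℤ)) : Xgh κ (u + v) = shiftK (-v) (Xgh κ u) := by
  rw [Xgh, Xgh, shiftK_sub, ghCur_translate, etD_translate, ← comp_shiftK, ← comp_shiftK, shiftK_lapU]

end Stencils

/-! ## §4 The torus identities (every `s`) -/

section Torus

variable (κ : Fin 4) (u : (Fin 4 → ℤ))

/-- [folklore] **`Ê_bᵀ D̂` AS TWO ARRAYS**: `(Djet s (σu,κ))ᵀ · D̂ = perT (arr (ghCnt κ u)) − perT (arr (ptPair (u+e_κ) u))`. -/
theorem transpose_Djet_mul_Dhat_eq_two : (Djet s (siteOf 4 s u, κ))ᵀ * Dhat 4 s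
    = perT s (arr s (ghCnt κ u)) - perT s (arr s (ptPair (u + unitVec κ) u)) := by
  ext x z
  rw [Matrix.sub_apply, perT_apply, perT_apply, transpose_Djet_mul_Dhat_apply, tip_siteOf, ghCnt_eq_ptPair, periodise_arr_ptPair,
    periodise_arr_ptPair]
  simp only [mul_sub, ite_zero_mul_ite_zero, mul_one]

/-- [folklore] **`Ê_bᵀ D̂ = perT (arr (etD κ u))`** — ONE array of the fixed stencil `etD κ u`. -/
theorem transpose_Djet_mul_Dhat_eq_perT : (Djet s (siteOf 4 s u, κ))ᵀ * Dhat 4 s = perT s (arr s (etD κ u)) := by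
  rw [transpose_Djet_mul_Dhat_eq_two, etD, arr_sub s (biLoc_ghCnt κ u 1) one_pos (biLoc_hop κ u 1) one_pos,
    perT_sub s (summable_row_arr s (biLoc_ghCnt κ u 1) one_pos) (summable_row_arr s (biLoc_hop κ u 1) one_pos)]

/-- [folklore] **`Ljet_b = perT (arr (ghCur κ u))`** (FILE 1's `Ljet_eq_arr`, in the `perT` spelling). -/
theorem Ljet_eq_perT : Ljet s (siteOf 4 s u, κ) = perT s (arr s (ghCur κ u)) := Ljet_eq_arr s κ u

/-- [folklore] **`Ljet_b · L̂ = perT (arr (ghCur κ u ∘ lapU))`**. -/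
theorem Ljet_mul_Lhat : Ljet s (siteOf 4 s u, κ) * Lhat s = perT s (arr s (comp (ghCur κ u) lapU)) := by
  rw [Ljet_eq_perT, Lhat_eq_perT, perT_arr_mul_perT s decays_lapU one_pos (lapU_imageShift s) (biLoc_ghCur κ u 1) one_pos]

/-- [folklore] **`L̂ · Ljet_b = perT (arr (lapU ∘ ghCur κ u))`**. -/
theorem Lhat_mul_Ljet : Lhat s * Ljet s (siteOf 4 s u, κ) = perT s (arr s (comp lapU (ghCur κ u))) := by
  rw [Ljet_eq_perT, Lhat_eq_perT, perT_mul_perT_arr s decays_lapU one_pos (lapU_imageShift s) (biLoc_ghCur κ u 1) one_pos]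

/-- [folklore] **`L̂ · (Ê_bᵀ D̂) = perT (arr (lapU ∘ etD κ u))`**. -/
theorem Lhat_mul_transpose_Djet_mul_Dhat :
    Lhat s * ((Djet s (siteOf 4 s u, κ))ᵀ * Dhat 4 s) = perT s (arr s (comp lapU (etD κ u))) := by
  rw [transpose_Djet_mul_Dhat_eq_perT, Lhat_eq_perT, perT_mul_perT_arr s decays_lapU one_pos (lapU_imageShift s) (biLoc_etD κ u 1) one_pos]

/-- [folklore] **THE `L̂²`-WORD AS ONE ARRAY**: `Ljet_b L̂ + L̂ Ljet_b = perT (arr (Lgh κ u))` at `b = (σu, κ)`, every `s`. -/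
theorem Lsq_word_eq_perT :
    Ljet s (siteOf 4 s u, κ) * Lhat s + Lhat s * Ljet s (siteOf 4 s u, κ) = perT s (arr s (Lgh κ u)) := by
  rw [Ljet_mul_Lhat, Lhat_mul_Ljet, Lgh,
    arr_add s (biLoc_comp_right (biLoc_ghCur κ u 1) decays_lapU (by norm_num : (0 : ℝ) ≤ 1 / 2) (by norm_num))
      (by norm_num : (0 : ℝ) < 1 / 2)
      (biLoc_comp_decays decays_lapU (biLoc_ghCur κ u 1) (by norm_num : (0 : ℝ) ≤ 1 / 2) (by norm_num)) (by norm_num : (0 : ℝ) < 1 / 2),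
    perT_add s
      (summable_row_arr s (biLoc_comp_right (biLoc_ghCur κ u 1) decays_lapU (by norm_num : (0 : ℝ) ≤ 1 / 2) (by norm_num))
        (by norm_num : (0 : ℝ) < 1 / 2))
      (summable_row_arr s (biLoc_comp_decays decays_lapU (biLoc_ghCur κ u 1) (by norm_num : (0 : ℝ) ≤ 1 / 2) (by norm_num))
        (by norm_num : (0 : ℝ) < 1 / 2))]

/-- [folklore] **THE GHOST WORD, MATRIX FORM**: `Mjet₁ b · D̂ = Ljet_b · L̂ − L̂ · (Ê_bᵀ D̂)` for every torus bond `b` (`D̂ᵀ D̂ = L̂`). -/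
theorem Mjet₁_mul_Dhat (b : Site 4 s × Fin 4) : Mjet₁ s b * Dhat 4 s = Ljet s b * Lhat s - Lhat s * ((Djet s b)ᵀ * Dhat 4 s) := by
  rw [Mjet₁, Matrix.sub_mul, Matrix.mul_assoc, Dhat_transpose_mul_Dhat, Matrix.mul_assoc]

/-- [folklore] **THE GHOST WORD AS ONE ARRAY**: `Mjet₁ (σu,κ) · D̂ = perT (arr (Xgh κ u))`, every `s` (owner ρ-g7-1 (1): the slot `𝒳 β` of
`KGhostTerm` §3 in the `arr` currency of `tendsto_hessT_hessKer`). -/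
theorem Mjet₁_mul_Dhat_eq_perT : Mjet₁ s (siteOf 4 s u, κ) * Dhat 4 s = perT s (arr s (Xgh κ u)) := by
  rw [Mjet₁_mul_Dhat, Ljet_mul_Lhat, Lhat_mul_transpose_Djet_mul_Dhat, Xgh,
    arr_sub s (biLoc_comp_right (biLoc_ghCur κ u 1) decays_lapU (by norm_num : (0 : ℝ) ≤ 1 / 2) (by norm_num))
      (by norm_num : (0 : ℝ) < 1 / 2)
      (biLoc_comp_decays decays_lapU (biLoc_etD κ u 1) (by norm_num : (0 : ℝ) ≤ 1 / 2) (by norm_num)) (by norm_num : (0 : ℝ) < 1 / 2),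
    perT_sub s
      (summable_row_arr s (biLoc_comp_right (biLoc_ghCur κ u 1) decays_lapU (by norm_num : (0 : ℝ) ≤ 1 / 2) (by norm_num))
        (by norm_num : (0 : ℝ) < 1 / 2))
      (summable_row_arr s (biLoc_comp_decays decays_lapU (biLoc_etD κ u 1) (by norm_num : (0 : ℝ) ≤ 1 / 2) (by norm_num))
        (by norm_num : (0 : ℝ) < 1 / 2))]

end Torus

end Summit.QuantumFields.BalabanUV.Beta.D1BFx.TorusGhostWordArrays

end
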